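import Literature.MathematicalPhysics.QuantumFieldTheory.Balaban1983to89.B9Eq346GradGpDivAtPinsL2Par
import Literature.MathematicalPhysics.QuantumFieldTheory.Balaban1983to89.B9B8KnitLetterCoerciveReg335

/-!
# `Balaban1983to89.B9Eq346GradGpDivAtPinsL2Knit` — T. Bałaban, *Propagators for lattice gauge theories in a background field*, Commun. Math. Phys. **99** (1985) 389–434
# [Balaban1985BackgroundPropagators] Thm 3.1 (3.46) p. 398 at the AVERAGED-BACKGROUND transporter of *Averaging operations for lattice gauge theories*, Commun. Math.
# Phys. **98** (1985) 17–51 [Balaban1985Averaging] (B8's knit table `parKnitY U = parOfT (bgT L (liftCfg U))`): ★★★ **(3.46)₄ FOR THE COMPOSITE LETTER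
# `DvcoKH ∘ GcoS(G′(parKnitY)) ∘ DvscoKH` OVER `blkBK bI` AT A MEMBER OF THE N06 CERTIFICATE, ON THE (3.35)∕(3.35′) CLASSES — the GENUINE knit estimate `h46K`**
# (link 7 = the instance of the CASCADE-K re-press of the (3.46)₄ chain, links 1–6 = `B9Thm31Site{GpDecay,AgmonWeight,GpGradDecay,GradGpDivDecay}Par`,
# `B9Eq346GradGpDiv{TorusL2,AtPinsL2}Par`; the coercivity root = `B9B8KnitLetterCoerciveReg335`)

statement-level skeleton of published theorems with citation tags; proofs where landed; nothing here is a claim about the Yang–Mills mass gap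

THE PRINT.  [B9] p. 398 (3.46): *«‖h∇_UG′(U)∇\*_Uλ‖ ≤ B₀·e^{−δ₀d(y,y′)}‖h‖‖λ‖»* for `G′(U)` the propagator of `Δ′_a(U)` (3.24) whose averaging part is built on B8's averaged
parallel transporters ((3.19) p. 393 with [B8] (52)); dag-n06-d's certificate displayed this line at `par := parSymY` (✓ `B9Eq346GradGpDivAtPinsL2Closed.blockBd_DvGcoSDvs_memberY_at`)
and WANTS it at the knit table (K3-D census: `h46K`).

WHAT IS PROVED (sorry-free; 0 `def`).  ★★★ `blockBd_DvGcoSDvs_memberY_knit`: for a class constant `c > 0` there are `M₄, a₄, B₄, δ₄ > 0` (on `d, ℓ, N, c`) such that for every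
`G ≤ U(N)` of contractions (`N ≥ 1`), every member `x` with `M₄ ≤ M_x`, B8's numerics `c₀ ≤ 10`, `α₀ > 0`, `α₀′` with `C0·α₀′ ≤ 1∕3`, `2α₀′ ≤ c2′`, `(d+1)²α₀′ ≤ 1∕100`,
`Kpl(M_xα₀)·L⁴ < α₀′` (the (3.69) smallness), every `α₁ > 0` with `M_x·α₁ ≤ a₄`, and every configuration `U` of the member in BOTH classes `Reg335′ c₀ α₀` (B8's, `bg9KP`) and
`Reg335 c α₁` (B9's, `bg9Y`), and the certificate's level-∕1-faithful `bI`, `R₀`, `H₀`: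
`BlockBd (toB6 (geo9Y x) R₀ H₀) (blkBK x.toKIdx bI) (blkBK x.toKIdx bI) (DvcoKH … U ∘ₗ GcoS … (GpY x.toKIdx (parKnitY x.toKIdx)) U ∘ₗ DvscoKH … U) (B₄·e^{−δ₄·(geo9Y x).dist})`.
PROOF.  Link 6's `blockBd_DvGcoSDvs_kIdx_par` at `κ₀ := 1∕32`, the laws discharged in the ambient group `U(N)`: legs unitary by F5 `parKnitY_mem_unitary_of_reg335P` (on (3.35′)),
inverse-symmetry by `parKnitY_inv` (always), coercivity `1∕32` by `B9B8KnitLetterCoerciveReg335.trIP_deltaPrimeAY_parKnitY_ge_levelMass_of_reg335P_reg335` (on both classes).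
HONEST SCOPE.  A block-`L²` bound for one finite lattice operator per member, uniform in the member, the volume, `k`, `N` and `U` on the classes; NOT a node discharge; count-neutral;
nothing continuum ∕ OS ∕ mass gap ∕ Clay.  Cell `pub-ymgap` (D-0062), Track A node N06 [B9], seat `pub-ymgap-dag-n06-l` (g37), 2026-08-30; NEW file; nothing landed is modified.
-/

noncomputable section

namespace Literature.MathematicalPhysics.QuantumFieldTheory.Balaban1983to89.B9Eq346GradGpDivAtPinsL2Knit

open Literature.MathematicalPhysics.QuantumFieldTheory.Balaban1983to89
open Node00 B6KLevelCensusIndexV1 B6Geom246MultiLevelBox B6MultiLevelTorusOperator B6GlobalChartV1 B9BackgroundsKLevelV1 B9Thm311ReadingCoords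
  B6Geom246MultiLevelTorus B9Eq346GradGpDivTorusL2 B9Eq346GradGpDivCoordsL2 B9Eq346GradGpDivAtPinsL2 B9Eq346GradGpDivAtPinsL2Par
open Literature.MathematicalPhysics.QuantumFieldTheory.Balaban1983to89.B6Ineq2142KLevelV1 (lvl β)
open Literature.MathematicalPhysics.QuantumFieldTheory.Balaban1983to89.B9GeoNormsKLevelV1 (geo9K)
open Literature.MathematicalPhysics.QuantumFieldTheory.Balaban1983to89.B9CoReadingCoords (XBK blkBK)
open Literature.MathematicalPhysics.QuantumFieldTheory.Balaban1983to89.B9CoReadingCoordsH (coordOpKH)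
open Literature.MathematicalPhysics.QuantumFieldTheory.Balaban1983to89.B9CoReadingCoordsS (XSK GcoS)
open Literature.MathematicalPhysics.QuantumFieldTheory.Balaban1983to89.B9CoReadingCoordsTranspose (TrIdx trBasis)
open Literature.MathematicalPhysics.QuantumFieldTheory.Balaban1983to89.B9Thm34Ext (toB6)
open Literature.MathematicalPhysics.QuantumFieldTheory.Balaban1983to89.B9SectDL2Decay (bl2 BlockBd)
open Literature.MathematicalPhysics.QuantumFieldTheory.Balaban1983to89.B9PinMembersKLevelV1 (MemberY geo9Y bg9Y reg335Y_iff)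
open Literature.MathematicalPhysics.QuantumFieldTheory.Balaban1983to89.Node00.OpsYSectDCoords (DvcoKH DvscoKH)
open Literature.MathematicalPhysics.QuantumFieldTheory.Balaban1983to89.B7Prop2Explicit (C0 c2' unitaryUnits)
open Literature.MathematicalPhysics.QuantumFieldTheory.Balaban1983to89.B9B8AveragingJunction (parKnitY parKnitY_inv)
open Literature.MathematicalPhysics.QuantumFieldTheory.Balaban1983to89.B9Eq3124HZKnitPairReg335Y (parKnitY_mem_unitary_of_reg335P)
open Literature.MathematicalPhysics.QuantumFieldTheory.Balaban1983to89.B9C2FormBoxRegimeY (Kpl)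
open Literature.MathematicalPhysics.QuantumFieldTheory.Balaban1983to89.B9BackgroundsKLevelV1P (bg9KP)
open Literature.MathematicalPhysics.QuantumFieldTheory.Balaban1983to89.B9B8KnitLetterCoerciveReg335 (trIP_deltaPrimeAY_parKnitY_ge_levelMass_of_reg335P_reg335)
open scoped Matrix Matrix.Norms.L2Operator

/-- ★★★ **(3.46)₄ FOR `DvcoKH ∘ GcoS(G′(parKnitY)) ∘ DvscoKH` OVER `blkBK bI` AT A MEMBER, ON THE CLASSES — THE GENUINE KNIT ESTIMATE `h46K`**, in dag-n06-d's `(M, a)`-regime prefix: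
for a class constant `c > 0` there are `M₄, a₄, B₄, δ₄ > 0` such that for `G ≤ U(N)` of contractions, `N ≥ 1`, `x : MemberY` with `M₄ ≤ M_x`, B8's numerics (`c₀ ≤ 10`, `α₀ > 0`,
`α₀′ > 0`, `C0·α₀′ ≤ 1∕3`, `2α₀′ ≤ c2′`, `(d+1)²α₀′ ≤ 1∕100`, `Kpl(M_xα₀)·L⁴ < α₀′`), `α₁ > 0` with `M_x·α₁ ≤ a₄`, and `U` in `Reg335′ c₀ α₀` (B8's class) and `Reg335 c α₁` (B9's),
`BlockBd (toB6 (geo9Y x) R₀ H₀) (blkBK x.toKIdx bI) (blkBK x.toKIdx bI) (DvcoKH … U ∘ₗ GcoS … (GpY x.toKIdx (parKnitY x.toKIdx)) U ∘ₗ DvscoKH … U) (B₄·e^{−δ₄·dist})`.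
[cite: Balaban1985BackgroundPropagators, Thm 3.1 (3.46)–(3.47) p.398, (3.19) p.393, (3.24) p.394, (3.35) p.396; Balaban1985Averaging, (52) p.32, Thm 2; Balaban1984PropagatorsII, (2.46) p.231, (2.51)–(2.54) pp.232–233, Lemma 2.1 (2.61) p.234; Agmon1982, Ch.1, Thm 1.5] -/
theorem blockBd_DvGcoSDvs_memberY_knit (d ℓ : ℕ) (hd : 1 ≤ d + 1) (hL : Odd (ℓ + 1) ∧ 1 < ℓ + 1) (b₀ b₁ : ℝ) (Mstar : ℕ) (N : ℕ) [NeZero N] {c : ℝ} (hc : 0 < c) :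
    ∃ M₄ a₄ B₄ δ₄ : ℝ, 0 < M₄ ∧ 0 < a₄ ∧ 0 < B₄ ∧ 0 < δ₄ ∧
      ∀ {G : Subgroup (Matrix (Fin N) (Fin N) ℂ)ˣ} (_ : ∀ u : (Matrix (Fin N) (Fin N) ℂ)ˣ, u ∈ G → ‖(u : Matrix (Fin N) (Fin N) ℂ)‖ ≤ 1)
        (_ : G ≤ unitaryUnits (Matrix (Fin N) (Fin N) ℂ)) (x : MemberY d ℓ hd hL b₀ b₁ Mstar), M₄ ≤ (geo9Y x).M →
      ∀ {c₀ : ℝ} (_ : c₀ ≤ 10) (α₀ : ℝ) (_ : 0 < α₀) {α₀' : ℝ} (_ : 0 < α₀') (_ : C0 (d + 1) * α₀' ≤ 1 / 3) (_ : 2 * α₀' ≤ c2' (d + 1) (ℓ + 1))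
        (_ : ((d : ℝ) + 1) ^ 2 * α₀' ≤ 1 / 100) (_ : Kpl x.toKIdx ((geo9Y x).M * α₀) * (geo9Y x).L ^ 4 < α₀')
        (α₁ : ℝ) (_ : 0 < α₁) (_ : (geo9Y x).M * α₁ ≤ a₄)
        (U : (bg9Y (Matrix (Fin N) (Fin N) ℂ) G x).Cfg) (_ : (bg9KP (Matrix (Fin N) (Fin N) ℂ) G x.toKIdx).Reg335 c₀ α₀ U)
        (_ : (bg9Y (Matrix (Fin N) (Fin N) ℂ) G x).Reg335 c α₁ U)
        {bI : FBondY x.toKIdx → IBondY x.toKIdx} (_ : ∀ f, lvl x.hN x.D x.hk (bI f) = (blkV1 x.hN x.D f).1.1)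
        (_ : ∀ f, (geomT x.D).dist (β x.hN x.D x.hk (bI f)) (blkV1 x.hN x.D f) ≤ 1) (R₀ : ℝ) (H₀ : Prop) [Fintype (geo9Y x).Site],
        BlockBd (g := toB6 (geo9Y x) R₀ H₀) (blkBK (κ := TrIdx N) x.toKIdx bI) (blkBK (κ := TrIdx N) x.toKIdx bI)
          (DvcoKH x.toKIdx (trBasis N) (bg9Y (Matrix (Fin N) (Fin N) ℂ) G x) (fun U => U) U ∘ₗ
            (GcoS x.toKIdx (trBasis N) (bg9Y (Matrix (Fin N) (Fin N) ℂ) G x) (fun U => U) (GpY x.toKIdx (parKnitY x.toKIdx)) U ∘ₗ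
              DvscoKH x.toKIdx (trBasis N) (bg9Y (Matrix (Fin N) (Fin N) ℂ) G x) (fun U => U) U))
          (fun a a' => B₄ * Real.exp (-(δ₄ * (geo9Y x).dist a a'))) := by
  obtain ⟨M₄, B₄, δ₄, hM₄, hB₄, hδ₄, H⟩ :=
    blockBd_DvGcoSDvs_kIdx_par d ℓ hd hL b₀ b₁ N (κ₀ := 1 / 32) (by norm_num) (by norm_num)
  refine ⟨M₄, 1 / (16 * c * ((d : ℝ) + 1)), B₄, δ₄, hM₄, by positivity, hB₄, hδ₄, ?_⟩
  intro G hG1 hGU x hM c₀ hc10 α₀ hα₀ α₀' hα' hα3 hα2 hαd hK α₁ hα₁ ha U hregP hregY bI hlev hβ1 R₀ H₀ _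
  haveI : Nonempty (Fin N) := ⟨⟨0, Nat.pos_of_ne_zero (NeZero.ne N)⟩⟩
  letI : Fintype (geo9K x.toKIdx).Site := (inferInstance : Fintype (geo9Y x).Site)
  have hM0 : 0 ≤ (geo9Y x).M := le_trans hM₄.le hM
  have hMα : 0 ≤ (geo9Y x).M * α₀ := mul_nonneg hM0 hα₀.le
  have hC0 : 0 ≤ c * (geo9Y x).M * α₁ := by positivity
  have hC1 : c * (geo9Y x).M * α₁ * ((d : ℝ) + 1) ≤ 1 / 16 := by
    have h1 : c * (geo9Y x).M * α₁ * ((d : ℝ) + 1) = (c * ((d : ℝ) + 1)) * ((geo9Y x).M * α₁) := by ring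
    rw [h1]
    calc c * ((d : ℝ) + 1) * ((geo9Y x).M * α₁) ≤ c * ((d : ℝ) + 1) * (1 / (16 * c * ((d : ℝ) + 1))) :=
          mul_le_mul_of_nonneg_left ha (by positivity)
      _ = 1 / 16 := by field_simp
  have hregK : (bg9K (Matrix (Fin N) (Fin N) ℂ) G x.toKIdx).Reg335 c α₁ U := ((reg335Y_iff x c α₁ U).1 hregY).1
  -- the three transporter laws at the knit table, in the ambient group `U(N)`
  have hU : ∀ μ y, U μ y ∈ unitaryUnits (Matrix (Fin N) (Fin N) ℂ) := fun μ y => hGU (hregK.1 μ y)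
  have hpar : ∀ z w : SiteY x.toKIdx, parKnitY x.toKIdx U z w ∈ unitaryUnits (Matrix (Fin N) (Fin N) ℂ) :=
    fun z w => parKnitY_mem_unitary_of_reg335P x.toKIdx hG1 hGU U hc10 hMα hregP hα' hα3 hα2 hK z w
  have hinv : ∀ z z' : SiteY x.toKIdx, parKnitY x.toKIdx U z z' = (parKnitY x.toKIdx U z' z)⁻¹ := fun z z' => parKnitY_inv x.toKIdx U z z'
  have hcoer : ∀ Φ : SiteY x.toKIdx → Matrix (Fin N) (Fin N) ℂ,
      (1 / 32 : ℝ) * ∑ z : SiteY x.toKIdx, (((((ℓ + 1) ^ (blkOf x.D.toDomains z).1.1 : ℕ) : ℝ)) ^ 2)⁻¹ * ∑ a, ∑ b, ‖Φ z a b‖ ^ 2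
        ≤ trIP (fun _ => (1 : ℝ)) Φ (deltaPrimeAY x.toKIdx (parKnitY x.toKIdx) U Φ) :=
    fun Φ => trIP_deltaPrimeAY_parKnitY_ge_levelMass_of_reg335P_reg335 x.toKIdx hGU hc10 hMα hregP hα' hα3 hα2 hαd hK hC0 hC1 hregK Φ
  exact H x.toKIdx hM x.hcfk (G := unitaryUnits (Matrix (Fin N) (Fin N) ℂ)) le_rfl (bg9Y (Matrix (Fin N) (Fin N) ℂ) G x) (fun U => U)
    (parKnitY x.toKIdx) U hU hpar hinv hcoer hlev hβ1 R₀ H₀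

end Literature.MathematicalPhysics.QuantumFieldTheory.Balaban1983to89.B9Eq346GradGpDivAtPinsL2Knit

end
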